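import Summits.BirchSwinnertonDyer.Rank1Residual.GaloisImage.PotMultLargeImage
import Summits.BirchSwinnertonDyer.Rank1Residual.GaloisImage.KolyvaginPrimeSmallImage
import Summits.BirchSwinnertonDyer.Rank1Residual.X11b.MultiplicativeSurjectivityTwist
import Summits.BirchSwinnertonDyer.Rank1Residual.X11b.BDPRouteTamagawaSupport
import Summits.BirchSwinnertonDyer.Rank1Residual.Additive.GordTwistOrdinary
import Summits.BirchSwinnertonDyer.Rank1Residual.AdditivePotMult.TwistSupplyJ
import Literature.NumberTheory.EllipticCurves.Rank1Residual.X9ImageShape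
import Literature.NumberTheory.EllipticCurves.Rank1Residual.X9SmallImage
import Literature.NumberTheory.EllipticCurves.Rank1Residual.X9NoEntry
import Literature.NumberTheory.EllipticCurves.Kato2004.Condition1252
import Literature.NumberTheory.EllipticCurves.ComplexMultiplicationHasCMProofs
import HarnessLib

/-!
# O8 — class X4 with NON-SURJECTIVE mod-`p` image at the ADDITIVE prime `p`: every image hypothesis
# of every printed route fails (kernel), no twist escapes, and the anatomy of the class
# (cell `b2b-bsdres`, team n1011, OWNERS row T-O8, seat `b2b-bsdres-n1011-p04`)

HONEST FRAMING (cell `b2b-bsdres`, run/shared/lean/b2b/bsd-rank1-residual/, verbatim in every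
file): the goal of the cell is to DELETE the COMBINATION-SHAPED residual classes of the
Birch–Swinnerton-Dyer formula for ALL analytic-rank `≤ 1` elliptic curves over `ℚ` — "full BSD
formula for every rank `≤ 1` curve in class `C`" assembled STRICTLY from published theorems — so
that the rank-`≤ 1` remainder becomes exactly the CONSTRUCTION-SHAPED classes, which are TYPED
(missing-input `Prop`s), NOT attempted. This is not "finishing BSD". Team n1011 (N10 / N11 + the
O7 rank-one strand + the O8 image strand): prove what is provable now; shrink each hard class to its
core with data; no claim beyond stated classes. THEOREMS ONLY (no definition, no named fact minted;
ONE published named fact — Balakrishnan–Dogra–Müller–Tuitman–Vonk 2019 Thm. 1.2 with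
Bilu–Parent–Rebolledo 2013 Cor. 1.2, tree fact
`BalakrishnanEtAl2019.thm12_not_le_normalizer_splitCartan` — enters §3 as an explicit binder `hB`).
O8 stays OPEN; the label X4 is UNCHANGED; nothing is booked by this file.

## The class

RESIDUAL-MAP §I item **O8**: the pairs `(E, p)` of class X4 (`p ≠ 2`, ADDITIVE reduction at `p`,
`E[p]` irreducible: `ClassX4 W p`) whose mod-`p` representation `ρ̄_{E,p}` is NOT onto
(`¬ Surj W p`); census image labels `3Nn / 3Ns / 5Nn / 5Ns / 5S4 / 7Nn / 7Ns / 13S4`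
(S-b sweep `N < 5·10⁵`: 1 726 pairs = 1 049 of analytic rank `0` + 677 of rank `1`; rmap-2
`census/x4_image_split.json`, additive-p1 `census-g13/`). "DECOMPOSED READING (rmap-2 g6): O8 =
(the additive input of N10/N11/O5–O7) × (N2/N3's small-image integral Euler-system input, here at an
additive prime)".

## What this file proves

§1 **Every IMAGE hypothesis of every printed rank-≤1 `p`-part route at an additive prime FAILS on
O8, by name** (`O8.image_hypotheses_fail`): Kato 2004 Thm. 12.5 (4) / 14.5 (3) / 17.4 (3)
hypothesis (12.5.2) `Kato2004.ImageContainsSL2 W p` (the V20X reading A154/A161 of N11 and the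
`ω^{(p−1)/2}`-component reading of the (M)/(G-ord) twist routes); the `p`-adic tower
`∀ n, ρ̄_{E,p^n}` onto (Kim–Nakamura 2020 at `p = 3`); Kato Thm. 13.4 (3) = Mazur–Rubin's useful
element = Burungale–Castella–Skinner's (im) `BigIm W p` (Kim 2026 Thm. 1.8 / 1.10 ask for the stronger
`Surj`); (ram) and (sst) (Skinner 2016 Thm. C, Skinner–Urban 2014, Jetchev–Skinner–Wan 2017); and
every Kolyvagin prime `ℓ ∈ 𝒫₁(E,p)` has `p² ∣ #Ẽ(𝔽_ℓ)`, so Kurihara's cyclic levels `𝒫_{1,0}` are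
EMPTY (`O8.sq_dvd_reductionPointCount_of_isKolyvaginPrime`). All are compositions of tree theorems
(Serre 1972 Prop. 15 read backwards: `not_bigIm_of_irr_of_not_surj`, `not_ram_of_irr_of_not_surj`,
`GaloisImage.galoisRepTorsion_frobenius_eq_one_of_irr_of_not_surj`; Kato's
`not_imageContainsSL2_of_not_hasSurjectiveModNGaloisRep`). Nothing here rests on "Kato at a
non-surjective prime" (REFEREE-2 R8): the Kato predicate appears only NEGATED.

§2 **No quadratic twist escapes** (`O8.no_twist_escape`): mod-`p` (non-)surjectivity and
irreducibility are twist invariants (`surj_iff_of_model_twist`, `irr_iff_of_model_twist`), so for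
every model `Wd` of a quadratic twist `E^{(d)}` the same three image hypotheses fail — in particular
for the `p`-SEMISTABLE twist `E♭ = E^{(p*)}` of the cell's (M)/(G-ord, `e = 2`) routes
(`AdditivePotMult/*ChiBranch*`, `Additive/Gord*`), whose Kato input needs (12.5.2) for `E♭`.

§3 **Anatomy — the class has no tail of large primes on its two `p`-semistable-twist sub-cells**
(given `hB`): on the potentially MULTIPLICATIVE locus (`ord_p j < 0`), `p ∣ ord_p j(E)` (Tate-curve
inertia transvection otherwise; x11c / multr1) and `p ∈ {5, 7}` when `p ≥ 5`
(`ClassX4M.eq_five_or_eq_seven_of_not_surj`, x11c gen 7); on the potentially good ORDINARY locus of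
semistability defect `2` (Kodaira `I₀*`: `TypeGOrd W p ∧ semistabilityIndex W p = 2`, non-CM),
**`p ∈ {5, 7}` when `p ≥ 5`** (`O8.eq_five_or_eq_seven_of_typeGOrd_two`, NEW): the twist
`E^{(p*)}` is GOOD ORDINARY at `p` (additive-p2's `exists_goodOrd_twist_pStar_of_typeGOrd`), has the
same `j`, irreducible non-surjective `ρ̄`, hence (Serre 1972 §1.11 + Prop. 14 + Prop. 17, the x9
seat's `exists_splitCartan_normalizer_of_goodOrd`) an image normalising a split Cartan subgroup for
`p ≥ 11` — excluded for non-CM curves by Bilu–Parent–Rebolledo / BDMTV (`hB`). So the three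
"irreducible non-surjective at `p ≥ 5`" families X9 (good ordinary), X11 ∧ ¬ram / X4(M)
(multiplicative twist) and NOW X4 ∧ (G-ord, `e = 2`) (good-ordinary twist) all live at `p ∈ {5, 7}`;
what this file does NOT bound is the potentially SUPERSINGULAR part of O8 (twist good supersingular,
`e = 2`: non-split Cartan normaliser, Serre uniformity open) and the defect `e ∈ {3, 4, 6}` / wild-`3`
part (the census's nine `13S4` pairs are potentially good ordinary of defect `3` or `6`: the defect-2
argument does not extend verbatim — the inertia eigenvalue ratio may have order `4`).

§4 **The Tamagawa obstruction of the per-pair levers is STRUCTURAL on O8**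
(`O8.dvd_tamagawaProduct_of_split`, `O8.dvd_tamagawaProduct_iff_exists_split`): since no
multiplicative prime `ℓ` may ramify in `E[p]` (§1 (iv): `p ∣ v_ℓ(Δ_min)` at EVERY multiplicative
`ℓ`), and `c_ℓ = v_ℓ(Δ_min)` at a SPLIT multiplicative prime (Kodaira–Néron; x11b's
`dvd_tamagawaProduct_of_split_of_dvd`), every split multiplicative prime of an O8 curve carries
`p ∣ c_ℓ`; for `p ≥ 5` this is an EQUIVALENCE: `p ∣ ∏_ℓ c_ℓ(E) ⟺ E` has a split multiplicative
prime. So the Tamagawa hypothesis `p ∤ #E(ℚ)_tors · ∏ c_ℓ` of the Matar–Nekovář certificate levers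
(additive-p1 GEN 13) fails on O8 EXACTLY at the curves with a split multiplicative prime (plus, at
`p = 3`, the rows with a Kodaira `IV / IV*` fibre of `c = 3`) — the census's "675 of 677 rank-one
O8 pairs Tamagawa-obstructed" is this theorem read on Cremona's table, and the per-pair ideation
target for O8 is therefore a Tamagawa-TOLERANT Heegner-index bound under irreducibility only at a
prime dividing the conductor (Jetchev 2008's refinement needs (∗) `p ∤ 2N` and `GL₂`-image).

## What O8 keeps (honest)

CLASS LEVEL: OPEN — the missing input is the SAME as N2/N3's (X10b `MazurMainConjecture W 3`, X9
`IntegralMainConjectureOnClassX9`): an INTEGRAL Euler-system / Kolyvagin-system divisibility for a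
residually dihedral (Cartan-normaliser) or exceptional (`𝔖₄`) image, here composed with the
additive-prime input of N10/N11 (team file `cells/n1011/O8-IDEATION.md`). PER PAIR the class is NOT
leverless: Matar–Nekovář 2019 Thm. 6.7 (1) / Thm. 0.3 (tree facts, irreducibility only, NO
reduction hypothesis at `p`) are additive-p1 GEN 13's levers `ClassX4.bsdp_rankZero_of_indexCertificate_of_odd`,
`ClassX4.bsdp_rankZero_of_indexBound_of_exists_torsion_of_odd`, `ClassX4M.bsdp_rankOne_of_indexCertificate`
(453 rank-`0` kernel records, `AdditivePotMult/HeegnerIndexRecordsIrreducibleRankZero1–8`); their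
reach and the Tamagawa-obstructed remainder are tabulated in `cells/n1011/O8-SUBPARTITION.md`.

References: J.-P. Serre, Invent. Math. 15 (1972) §1.11, §2.4 Prop. 15, §2.7 Prop. 17 [Serre1972];
K. Kato, Astérisque 295 (2004) Thm. 12.5 (4) (12.5.2) p. 222, Thm. 13.4 (3) p. 226, Thm. 14.5 (3)
p. 236 [Kato2004Asterisque]; A. Burungale, F. Castella, C. Skinner, IMRN 2025 (im), Rem. 1.1.3 (iii)
[BurungaleCastellaSkinner2025]; C.-H. Kim, Amer. J. Math. 148 (2026) Thm. 1.8, Thm. 1.10, §1.2.5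
[Kim2022StructureSelmer]; Balakrishnan–Dogra–Müller–Tuitman–Vonk, Ann. of Math. 189 (2019) Thm. 1.2
[BalakrishnanEtAl2019]; Bilu–Parent–Rebolledo, Ann. Inst. Fourier 63 (2013) Cor. 1.2; J. H. Silverman,
*Advanced Topics* V.5.3, V.6 Prop. 6.1 [SilvermanATAEC1994]; A. Matar, J. Nekovář, JTNB 31 (2019)
Thm. 6.7 (1), Thm. 0.3 [MatarNekovar2019]; RESIDUAL-MAP.md §I O8, §D; cells/n1011/skel/T-O8.md.
-/

noncomputable section

open scoped Classical

open WeierstrassCurve Literature.NumberTheory.EllipticCurves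
  Literature.NumberTheory.EllipticCurves.Rank1Residual
  Literature.NumberTheory.EllipticCurves.BalakrishnanEtAl2019

namespace Summit.BirchSwinnertonDyer.Rank1Residual.Additive

variable (W : WeierstrassCurve ℚ) [W.IsElliptic] (p : ℕ) [hp : Fact p.Prime]

/-! ### §1 Every image hypothesis of every printed route fails on O8 -/

/-- **O8 ⟹ ¬(im).** On an O8 pair (`ClassX4 W p`: `p ≠ 2`, additive at `p`, `E[p]` irreducible;
`ρ̄_{E,p}` not onto) Kato's Thm. 13.4 (3) hypothesis = Mazur–Rubin's useful Galois element =
Burungale–Castella–Skinner's (im) (`BigIm W p`: some `σ ∈ G_{ℚ(μ_{p^∞})}` with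
`T_pE/(σ−1)T_pE ≅ ℤ_p`) FAILS: such a `σ` would act on `E[p]` by a transvection, and a proper
irreducible subgroup of `GL₂(𝔽_p)` with full determinant contains none (Serre 1972 Prop. 15; x9's
`not_bigIm_of_irr_of_not_surj`). Kim 2026 Thm. 1.8 / 1.10 and Kim–Nakamura 2020 ask for the stronger
`Surj W p`, false by definition of O8. [cite: Serre1972, §2.4 Prop. 15]
[cite: Kato2004Asterisque, Thm. 13.4 (3) (p. 226)] [cite: BurungaleCastellaSkinner2025, p. 2 hypothesis (im), Rem. 1.1.3 (iii)] -/
theorem O8.not_bigIm (hX : ClassX4 W p) (hns : ¬ Surj W p) : ¬ BigIm W p :=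
  not_bigIm_of_irr_of_not_surj W p hX.2.2 hns

/-- **O8 ⟹ ¬(ram).** On an O8 pair there is no ramified multiplicative prime `ℓ ≠ p` with
`p ∤ v_ℓ(Δ_min)` (it would supply an inertia transvection and force `ρ̄_{E,p}` onto): the (ram)
binder of Skinner 2016 Thm. C / Skinner–Urban 2014 / the `p = 3` tower lemma
`hasSurjectiveModNGaloisRep_pow_of_hasMultiplicativeReductionAtPrime` cannot be instantiated.
[cite: Serre1972, §2.4 Prop. 15] [cite: SilvermanATAEC1994, V.4–V.5 and Exercise 5.13(b)] -/
theorem O8.not_ram [W.IsGloballyMinimal] (hX : ClassX4 W p) (hns : ¬ Surj W p) : ¬ Ram W p :=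
  not_ram_of_irr_of_not_surj W p hX.2.2 hns

omit [W.IsElliptic] in
/-- **O8 ⟹ ¬(sst)**, trivially: `E` is additive at `p`, so not semistable (the binder of
Jetchev–Skinner–Wan 2017 Thm. 1.2.1 and of the Kato-side semistable readings). [folklore] -/
theorem O8.not_semistable (hX : ClassX4 W p) : ¬ Semistable W := by
  intro hsst
  rcases hsst p hp.out with hgood | hmult
  · exact hX.2.1.1 hgood
  · exact hX.2.1.2 hmult

/-- **O8 ⟹ every Kolyvagin prime is useless for Kurihara numbers**: for `ℓ ∈ 𝒫₁(E,p)`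
(`ℓ ∤ Np`, `ℓ ≡ 1`, `a_ℓ ≡ ℓ + 1 (mod p)`: `Kato.IsKolyvaginPrime W p 1 ℓ`) one has
`p² ∣ #Ẽ(𝔽_ℓ)` — Frobenius at `ℓ` is TRIVIAL on `E[p]` (additive-p3 gen 5,
`GaloisImage.sq_dvd_reductionPointCount_of_isKolyvaginPrime`), so Kurihara's / Sakamoto's cyclic
level set `𝒫_{1,0}` is empty, `𝒩_{1,0} = {1}`, and the only Kurihara number is `δ̃_1 = L(E,1)/Ω⁺`:
the typed input `X4.KuriharaUnitAt W p` carries no information beyond `L(E,1)` on O8.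
[cite: Kim2022StructureSelmer, §1.2.2 and Thm. 1.10 (journal; v4 Thm. 1.11)] [cite: Serre1972, §2.4 Prop. 15] -/
theorem O8.sq_dvd_reductionPointCount_of_isKolyvaginPrime [W.IsGloballyMinimal] (hX : ClassX4 W p)
    (hns : ¬ Surj W p) {ℓ : ℕ} (hK : Kato.IsKolyvaginPrime W p 1 ℓ) :
    p ^ 2 ∣ W.reductionPointCount ℓ :=
  GaloisImage.sq_dvd_reductionPointCount_of_isKolyvaginPrime W p hX.2.2 hns hK

/-- **O8: every IMAGE hypothesis of every printed rank-≤1 `p`-part route at an additive prime fails,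
by name** (assembly, the X4-at-its-own-prime twin of `ClassX9.no_published_entry` /
`ClassX10.no_published_entry_of_not_surj`): on `ClassX4 W p ∧ ¬ Surj W p`
(i) Kato 2004 (12.5.2) `Kato2004.ImageContainsSL2 W p` — the hypothesis of Thm. 12.5 (4), of
Thm. 14.5 (3) + Prop. 14.16 (2) (the V20X reading of N11) and of Thm. 17.4 (3) — fails;
(ii) the `p`-adic tower `∀ n, ρ̄_{E,p^n}` onto (Kim–Nakamura 2020 at `p = 3`, the mod-`9` / Frobenius
certificates of lit-kato) fails at `n = 1`; (iii) (im) `BigIm W p` fails; (iv) (ram) fails;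
(v) (sst) fails. PER PAIR the class still has the Matar–Nekovář Heegner-index levers of additive-p1
GEN 13 (irreducibility only) — see the module docstring; nothing is booked; O8 stays OPEN.
[cite: Kato2004Asterisque, (12.5.2) in Thm. 12.5 (4) (p. 222); Thm. 13.4 (3) (p. 226); Thm. 14.5 (3) (p. 236)]
[cite: Serre1972, §2.4 Prop. 15] [cite: BurungaleCastellaSkinner2025, p. 2 hypothesis (im)] -/
theorem O8.image_hypotheses_fail [W.IsGloballyMinimal] (hX : ClassX4 W p) (hns : ¬ Surj W p) :
    ¬ Kato2004.ImageContainsSL2 W p ∧ ¬ (∀ n : ℕ, W.HasSurjectiveModNGaloisRep (p ^ n)) ∧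
      ¬ BigIm W p ∧ ¬ Ram W p ∧ ¬ Semistable W := by
  refine ⟨Kato2004.not_imageContainsSL2_of_not_hasSurjectiveModNGaloisRep W p hns, ?_,
    O8.not_bigIm W p hX hns, O8.not_ram W p hX hns, O8.not_semistable W p hX⟩
  intro h
  have h1 := h 1
  rw [pow_one] at h1
  exact hns h1

/-! ### §2 No quadratic twist escapes -/

/-- **Mod-`p` non-surjectivity survives every quadratic twist**: for `d ≠ 0` and any model `Wd` of
`E^{(d)}` (`C • W.quadraticTwist d = Wd`), `ρ̄_{Wd,p}` is not onto either
(`ρ̄_{E^{(d)},p} = ρ̄_{E,p} ⊗ χ_d`; additive-p2's `surj_iff_of_model_twist`). So the cell's twist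
routes — (M): `E♭ = E^{(p*)}` multiplicative at `p`; (G-ord, `e = 2`): `E♭` good ordinary at `p` —
meet on O8 a twist `E♭` that is again non-surjective at `p`. [folklore] -/
theorem O8.not_surj_of_model_twist (hns : ¬ Surj W p) {d : ℚ} (hd : d ≠ 0)
    {Wd : WeierstrassCurve ℚ} (hWd : ∃ C : VariableChange ℚ, C • W.quadraticTwist d = Wd) :
    ¬ Surj Wd p :=
  fun h ↦ hns ((surj_iff_of_model_twist W p hd hWd).mp h)

/-- **No twist escapes O8's image obstruction**: for an O8 pair and ANY model `Wd` of a quadratic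
twist `E^{(d)}` (`d ≠ 0`), the three image hypotheses fail for `Wd` as well — `ρ̄_{Wd,p}` not onto,
Kato's (12.5.2) `ImageContainsSL2 Wd p` false, (im) `BigIm Wd p` false (irreducibility is a twist
invariant, additive-p1's `irr_iff_of_model_twist`). In particular the Kato / Kato-component inputs
of the (M) and (G-ord, `e = 2`) twist routes, which need (12.5.2) for the `p`-semistable twist
`E^{(p*)}`, are unavailable on O8. [cite: Kato2004Asterisque, (12.5.2) in Thm. 12.5 (4) (p. 222); Thm. 17.4 (3) (p. 273)]
[cite: Serre1972, §2.4 Prop. 15] -/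
theorem O8.no_twist_escape (hX : ClassX4 W p) (hns : ¬ Surj W p) {d : ℚ} (hd : d ≠ 0)
    {Wd : WeierstrassCurve ℚ} [Wd.IsElliptic] (hWd : ∃ C : VariableChange ℚ, C • W.quadraticTwist d = Wd) :
    ¬ Surj Wd p ∧ ¬ Kato2004.ImageContainsSL2 Wd p ∧ ¬ BigIm Wd p := by
  have hns' : ¬ Surj Wd p := O8.not_surj_of_model_twist W p hns hd hWd
  have hirr' : Irr Wd p := (AdditivePotMult.irr_iff_of_model_twist (W := W) hd hWd).mpr hX.2.2
  exact ⟨hns', Kato2004.not_imageContainsSL2_of_not_hasSurjectiveModNGaloisRep Wd p hns',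
    not_bigIm_of_irr_of_not_surj Wd p hirr' hns'⟩

/-! ### §3 Anatomy: no tail of large primes on the two `p`-semistable-twist sub-cells -/

/-- **O8 ∩ (M): `p ∣ ord_p j(E)`.** At a potentially MULTIPLICATIVE additive prime
(`AdditivePotMult.PotMult W p`: `Addv ∧ ord_p j < 0`) with `E[p]` irreducible and `ρ̄` not onto,
`p` divides `ord_p j(E)`: otherwise the Tate-curve inertia of the multiplicative twist supplies a
transvection (x11c / multr1, `ClassX4M.dvd_padicValRat_j_of_not_surj`). Census shadow: the 116
(M) rows of O8 ∧ `r = 0` (RESIDUAL-MAP §E E-ii) all have `p ∣ ord_p j`.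
[cite: SilvermanATAEC1994, V.6 Prop. 6.1 (p. 410) and V.5.3] [cite: Serre1972, §2.4 Prop. 15] -/
theorem O8.dvd_padicValRat_j_of_potMult (hX : ClassX4 W p) (hns : ¬ Surj W p)
    (hpm : AdditivePotMult.PotMult W p) : (p : ℤ) ∣ padicValRat p W.j :=
  AdditivePotMult.ClassX4M.dvd_padicValRat_j_of_not_surj (W := W) (p := p) ⟨hX, hpm⟩ hns

/-- **O8 ∩ (M) lives at `p ∈ {3, 5, 7}`**: at a potentially multiplicative additive `p ≥ 5` with
`E[p]` irreducible and `ρ̄` not onto, `p = 5 ∨ p = 7` — granted the PUBLISHED split-Cartan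
classification `hB` (BDMTV 2019 Thm. 1.2 with Bilu–Parent–Rebolledo 2013 Cor. 1.2), via the
multiplicative twist (x11c gen 7, `ClassX4M.eq_five_or_eq_seven_of_not_surj`). Restated in O8's
hypothesis shape for the sub-partition. [cite: BalakrishnanEtAl2019, §1 Thm. 1.2 (arXiv:1711.05846 p. 2)] -/
theorem O8.eq_five_or_eq_seven_of_potMult (hB : thm12_not_le_normalizer_splitCartan)
    (hX : ClassX4 W p) (hns : ¬ Surj W p) (hpm : AdditivePotMult.PotMult W p) (h5 : 5 ≤ p) :
    p = 5 ∨ p = 7 :=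
  AdditivePotMult.ClassX4M.eq_five_or_eq_seven_of_not_surj (W := W) (p := p) hB ⟨hX, hpm⟩ h5 hns

/-- **O8 ∩ (G-ord, `e = 2`) lives at `p ∈ {3, 5, 7}` (NEW).** Let `(E, p)` be an O8 pair
(`ClassX4 W p`, `¬ Surj W p`) with `E` non-CM, at a potentially good ORDINARY prime of semistability
defect `2` (Delbourgo's (G)-ordinary on Kodaira `I₀*`: `TypeGOrd W p ∧ semistabilityIndex W p = 2`),
`p ≥ 5`. Then `p = 5 ∨ p = 7`. Proof: additive-p2's `exists_goodOrd_twist_pStar_of_typeGOrd`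
produces a globally minimal model `Wd` of `E^{(p*)}`, `p* = (−1)^{(p−1)/2} p`, with GOOD ORDINARY
reduction at `p`; `Wd` has the same `j` (so is non-CM), irreducible and NON-surjective `ρ̄_{Wd,p}`
(twist invariance); for a prime `p ≥ 11` Serre's §1.11 + Prop. 14 + Prop. 17 (the x9 seat's kernel
theorem `exists_splitCartan_normalizer_of_goodOrd`) put the image of `ρ̄_{Wd,p}` inside the
normaliser of a split Cartan subgroup — impossible for a non-CM curve by Bilu–Parent–Rebolledo 2013
(`p ≥ 11`, `p ≠ 13`) and Balakrishnan–Dogra–Müller–Tuitman–Vonk 2019 (`p = 13`), the named fact `hB`.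
So, with X9 (`ClassX9.eq_five_or_eq_seven`) and X4(M) (`ClassX4M.eq_five_or_eq_seven_of_not_surj`),
every "irreducible non-surjective at `p ≥ 5`" family with a `p`-ORDINARY semistable twist is
supported at `p ∈ {5, 7}`; the potentially supersingular and defect-`3/4/6` parts of O8 are NOT
bounded here (census: nine `13S4` pairs at defect `3`/`6`). Nothing about `E`'s own image at `p = 7`
is claimed. [cite: BalakrishnanEtAl2019, §1 Thm. 1.2 (arXiv:1711.05846 p. 2)]
[cite: Serre1972, §1.11, §2.7 Prop. 17] [cite: SilvermanAEC2009, III.1.4(b)] -/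
theorem O8.eq_five_or_eq_seven_of_typeGOrd_two [W.IsGloballyMinimal]
    (hB : thm12_not_le_normalizer_splitCartan) (hX : ClassX4 W p) (hns : ¬ Surj W p)
    (hCM : ¬ W.HasCM) (hG : TypeGOrd W p) (he : semistabilityIndex W p = 2) (h5 : 5 ≤ p) :
    p = 5 ∨ p = 7 := by
  have hpP : p.Prime := hp.out
  by_contra hne
  push Not at hne
  have h7 : 7 < p := by
    rcases Nat.lt_or_ge 7 p with hlt | hle
    · exact hlt
    · exfalso
      interval_cases p
      · exact hne.1 rfl
      · exact absurd hpP (by decide)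
      · exact hne.2 rfl
  -- the good ORDINARY twist `E^{(p*)}`
  obtain ⟨Wd, hWdE, hWdM, C, hC, hord⟩ := exists_goodOrd_twist_pStar_of_typeGOrd W p h5 hG he
  have hd0 : ((-1 : ℚ) ^ (p / 2) * p) ≠ 0 :=
    mul_ne_zero (pow_ne_zero _ (by norm_num)) (by exact_mod_cast hpP.ne_zero)
  have hWd : ∃ C : VariableChange ℚ, C • W.quadraticTwist ((-1 : ℚ) ^ (p / 2) * p) = Wd := ⟨C, hC⟩
  have hirr' : Irr Wd p := (AdditivePotMult.irr_iff_of_model_twist (W := W) hd0 hWd).mpr hX.2.2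
  have hns' : ¬ Surj Wd p := O8.not_surj_of_model_twist W p hns hd0 hWd
  have hCM' : ¬ Wd.HasCM :=
    (hasCM_iff_of_j_eq (AdditivePotMult.j_of_model_twist (W := W) hd0 hWd)).not.mpr hCM
  -- a frame for `Wd[p]` and Serre's split-Cartan normaliser at a good ordinary `p ≥ 7`
  obtain ⟨e, Φ, heΦ, -⟩ := exists_frame_galoisRepTorsion_rat Wd p
  obtain ⟨P, -, hGN, -⟩ :=
    exists_splitCartan_normalizer_of_goodOrd Wd p Φ e heΦ (by omega) hord hirr' hns'
  exact hB Wd p hCM' h7 Φ e heΦ P hGN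

/-- **Anatomy of O8 at `p ≥ 5` on the `p`-semistable-twist locus** (given `hB`): for a non-CM O8 pair
with `p ≥ 5`, (a) if `p` is potentially multiplicative then `p ∈ {5, 7}` and `p ∣ ord_p j(E)`;
(b) if `p` is potentially good ordinary of defect `2` then `p ∈ {5, 7}`. The sub-partition of record
(`cells/n1011/O8-SUBPARTITION.md`) lists the remaining sub-cells — twist good SUPERSINGULAR
(`e = 2`), defect `e ∈ {3, 4, 6}`, and `p = 3` (`3Nn`/`3Ns`, wild or tame) — on which no prime bound
is claimed. [cite: BalakrishnanEtAl2019, §1 Thm. 1.2 (arXiv:1711.05846 p. 2)]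
[cite: SilvermanATAEC1994, V.6 Prop. 6.1 (p. 410) and V.5.3] -/
theorem O8.anatomy_of_five_le [W.IsGloballyMinimal] (hB : thm12_not_le_normalizer_splitCartan)
    (hX : ClassX4 W p) (hns : ¬ Surj W p) (hCM : ¬ W.HasCM) (h5 : 5 ≤ p) :
    (AdditivePotMult.PotMult W p → (p = 5 ∨ p = 7) ∧ (p : ℤ) ∣ padicValRat p W.j) ∧
      (TypeGOrd W p ∧ semistabilityIndex W p = 2 → p = 5 ∨ p = 7) :=
  ⟨fun hpm ↦ ⟨O8.eq_five_or_eq_seven_of_potMult W p hB hX hns hpm h5,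
      O8.dvd_padicValRat_j_of_potMult W p hX hns hpm⟩,
    fun hG ↦ O8.eq_five_or_eq_seven_of_typeGOrd_two W p hB hX hns hCM hG.1 hG.2 h5⟩


/-! ### §4 The Tamagawa obstruction of the per-pair levers is structural on O8 -/

/-- **O8 ⟹ `p ∣ ∏_ℓ c_ℓ(E)` as soon as `E` has a SPLIT multiplicative prime.** On an O8 pair no
multiplicative prime `ℓ` ramifies in `E[p]` (`O8.not_ram`: `p ∣ v_ℓ(Δ_min)` for every multiplicative
`ℓ ≠ p`, and `ℓ = p` is excluded since `E` is additive at `p`), while at a split multiplicative prime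
`c_ℓ(E) = v_ℓ(Δ_min)` (Kodaira–Néron, Silverman *ATAEC* Cor. IV.9.2; x11b's
`X11b.dvd_tamagawaProduct_of_split_of_dvd`). Hence `p ∣ c_ℓ ∣ ∏ c`: the Tamagawa hypothesis of the
Matar–Nekovář certificate levers (`ClassX4.bsdp_rankZero_of_indexCertificate_of_odd`,
`ClassX4M.bsdp_rankOne_of_indexCertificate`) fails at every O8 curve with a split multiplicative
prime — structurally, not by accident of the census (rank one: 675 of 677 S-b pairs obstructed).
[cite: SilvermanATAEC1994, Cor. IV.9.2(d) with (b) (PDF p. 340)] [cite: Serre1972, §2.4 Prop. 15] -/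
theorem O8.dvd_tamagawaProduct_of_split [W.IsGloballyMinimal] (hX : ClassX4 W p) (hns : ¬ Surj W p)
    {ℓ : ℕ} [Fact ℓ.Prime] (hs : W.HasSplitMultiplicativeReductionAtPrime ℓ) :
    p ∣ W.tamagawaProduct := by
  have hmult : W.HasMultiplicativeReductionAtPrime ℓ := hs.hasMultiplicativeReductionAtPrime
  have hℓp : ℓ ≠ p := by
    rintro rfl
    exact hX.2.1.2 hmult
  have hdvd : p ∣ padicValInt ℓ W.minimalDiscriminantInt := by
    by_contra hnd
    exact O8.not_ram W p hX hns ⟨ℓ, inferInstance, hℓp, hmult, hnd⟩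
  exact X11b.dvd_tamagawaProduct_of_split_of_dvd W hs hdvd

/-- **On O8 at `p ≥ 5`: `p ∣ ∏_ℓ c_ℓ(E)` IFF `E` has a split multiplicative prime.** (⇐) is
`O8.dvd_tamagawaProduct_of_split`; (⇒) a prime `p ≥ 5` dividing the Tamagawa product divides some
`c_ℓ`, and `c_ℓ ≤ 4` unless `ℓ` is split multiplicative (Kodaira–Néron; x11b's
`X11b.dvd_tamagawaProduct_iff_exists_split`). With `p ∤ #E(ℚ)_tors` (irreducible `E[p]`) this
DECIDES the Tamagawa binder of the per-pair Matar–Nekovář levers on O8 ∩ {p ≥ 5} from the list of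
split multiplicative primes alone; at `p = 3` the Kodaira `IV / IV*` fibres with `c = 3` add to it.
[cite: SilvermanATAEC1994, Cor. IV.9.2(d) with (b) (PDF p. 340)] [cite: Serre1972, §2.4 Prop. 15] -/
theorem O8.dvd_tamagawaProduct_iff_exists_split [W.IsGloballyMinimal] (hX : ClassX4 W p)
    (hns : ¬ Surj W p) (h5 : 5 ≤ p) :
    p ∣ W.tamagawaProduct ↔ ∃ ℓ : ℕ, ∃ _ : Fact ℓ.Prime, W.HasSplitMultiplicativeReductionAtPrime ℓ := by
  constructor
  · intro h
    obtain ⟨ℓ, hℓ, hs, -⟩ := (X11b.dvd_tamagawaProduct_iff_exists_split W hp.out h5).mp h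
    exact ⟨ℓ, hℓ, hs⟩
  · rintro ⟨ℓ, hℓ, hs⟩
    exact O8.dvd_tamagawaProduct_of_split W p hX hns hs

end Summit.BirchSwinnertonDyer.Rank1Residual.Additive

end
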